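import Literature.AlgebraicTopology.FundamentalGroup.VanKampenClosedCover
import HarnessLib

/-!
# Seifert–van Kampen for closed pieces: the universal-property (pushout) form

Topic `Literature/AlgebraicTopology/FundamentalGroup`; sibling of `VanKampenDeformation.lean`
and `VanKampenClosedCover.lean`, which prove the EPIMORPHIC form of van Kampen's theorem for
two closed pieces (the edge maps `π₁ F → π₁ R_a` surjective: Heegaard splittings, trisections).
This file proves the GENERAL form — Hatcher's Thm. 1.20 as a universal property — in the same
two settings, for gluings in which the edge maps are not onto: a closed surface cut along a
separating circle `Σ_{g+3} = (Σ_g ∖ D̊) ∪_C (Σ₃ ∖ D̊)` (the stabilised central surface of a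
trisection, `Literature/Topology/FourManifolds/TrisectionFunctorGKStabilizationKernel.lean`),
`3`-manifolds glued along a disc (free products), CW-type decompositions.

* `existsUnique_hom_of_deformationRetracts` — **open cover, closed pieces.**  `Y = U ∪ T` with
  `U`, `T` open and `U`, `T`, `U ∩ T` path connected; `P ⊆ U`, `Q ⊆ T`, `F ⊆ P ∩ Q`, `x₀ ∈ F`,
  with `P`, `Q`, `F` strong deformation retracts of `U`, `T`, `U ∩ T`.  Then for every group `G`
  and homomorphisms `φ_P : π₁(P, x₀) → G`, `φ_Q : π₁(Q, x₀) → G` which agree on `π₁(F, x₀)`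
  there is a UNIQUE `Φ : π₁(Y, x₀) → G` through which both factor:
  `π₁(Y) ≅ π₁(P) *_{π₁(F)} π₁(Q)` (Hatcher, Thm. 1.20, applied as in §1.2 to open
  neighbourhoods deformation retracting onto the pieces, Prop. 1.17);
  `hom_ext_of_deformationRetracts` (uniqueness alone) and
  `exists_hom_of_deformationRetracts_of_subsingleton` (`π₁ F = 1`: no compatibility needed —
  the free product `π₁(P) ∗ π₁(Q)`, e.g. two `3`-manifolds glued along a disc);
* `existsUnique_hom_of_closed_cover_collars` — **closed cover with collars.**  `R₁, R₂ ⊆ X`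
  closed with `R₁ ∩ R₂ = F ∋ x₀`, collars `F ⊆ C_a ⊆ R_a` open in `R_a` and strong deformation
  retracting onto `F`, `R₁`, `R₂`, `F` path connected: for `φ_a : π₁(R_a, x₀) → G` agreeing on
  `π₁(F, x₀)` there is a unique `Φ : π₁(R₁ ∪ R₂, x₀) → G` through which both factor (the maps
  being those induced by `R_a ⊆ R₁ ∪ R₂`); `hom_ext_of_closed_cover_collars`,
  `exists_hom_of_closed_cover_collars_of_subsingleton` likewise;
  `closure_range_union_eq_top_of_closed_cover_collars` (generation, Lemma 1.15);
* `surjective_and_ker_eq_of_closed_cover_collars_of_subsingleton_right` — **attaching a simply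
  connected piece** (`π₁ R₂ = 1`): `π₁(R₁) → π₁(R₁ ∪ R₂)` is onto with kernel the normal closure
  of the image of `π₁ F` (capping a boundary circle with a disc, Prop. 1.26 (a); filling a sphere
  with a ball); `bijective_of_closed_cover_collars_of_subsingleton` — if moreover `π₁ F = 1`
  (gluing along a disc, e.g. a half-ball bite at the boundary of a `3`-manifold) the map is
  bijective.

Proofs: the epimorphic files' passage to the open neighbourhoods `U = R₁ ∪ C₂`, `T = R₂ ∪ C₁`
(verbatim), Prop. 1.17 (`bijective_inclHomOfSubset_of_isStrongDeformationRetractOf`) to move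
the cone from the closed pieces to the open ones and back, and the universal property for open
covers (`existsUnique_hom_of_cover`, `VanKampenPushout.lean`).  Everything is proved; no
definitions, no named facts.

## References

* A. Hatcher, *Algebraic Topology*, CUP (2002), §1.2: Thm. 1.20 (van Kampen, universal
  property `π₁(⋃ A_α) ≅ ∗_α π₁(A_α) / N`), Prop. 1.17, and the remark on closed sets with
  deformation-retracting open neighbourhoods preceding Example 1.21. [HatcherAT2002]
-/

noncomputable section

open Set Function Topology

namespace Literature.AlgebraicTopology.FundamentalGroup

namespace VanKampen

variable {Y : Type*} [TopologicalSpace Y]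

/-! ### Open cover, closed pieces -/

section ClosedPieces

variable {U T P Q F : Set Y} {x₀ : Y}

/-- **Seifert–van Kampen for closed pieces through deformation-retracting open neighbourhoods,
universal-property form.**  Let `Y = U ∪ T` with `U`, `T` open and `U`, `T`, `U ∩ T` path
connected; let `P ⊆ U`, `Q ⊆ T`, `F ⊆ P ∩ Q`, `x₀ ∈ F`, with `P` a strong deformation retract of
`U`, `Q` of `T`, and `F` of `U ∩ T`.  Then for every group `G` and homomorphisms
`φ_P : π₁(P, x₀) → G`, `φ_Q : π₁(Q, x₀) → G` with `φ_P ∘ (F ⊆ P)_* = φ_Q ∘ (F ⊆ Q)_*` there is a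
unique `Φ : π₁(Y, x₀) → G` with `Φ ∘ (P ⊆ Y)_* = φ_P` and `Φ ∘ (Q ⊆ Y)_* = φ_Q` (Hatcher,
Thm. 1.20 for `U`, `T`, whose fundamental groups are those of `P`, `Q`, `F` by Prop. 1.17).
[cite: HatcherAT2002, Thm. 1.20 and Prop. 1.17] -/
theorem existsUnique_hom_of_deformationRetracts (hUo : IsOpen U) (hTo : IsOpen T)
    (hcov : U ∪ T = univ) (hUpc : IsPathConnected U) (hTpc : IsPathConnected T)
    (hmeet : IsPathConnected (U ∩ T)) (hPU : P ⊆ U) (hQT : Q ⊆ T) (hFP : F ⊆ P) (hFQ : F ⊆ Q)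
    (hxF : x₀ ∈ F) (hP : Homotopy.IsStrongDeformationRetractOf P U)
    (hQ : Homotopy.IsStrongDeformationRetractOf Q T)
    (hF : Homotopy.IsStrongDeformationRetractOf F (U ∩ T))
    {G : Type*} [Group G] (φP : _root_.FundamentalGroup P ⟨x₀, hFP hxF⟩ →* G)
    (φQ : _root_.FundamentalGroup Q ⟨x₀, hFQ hxF⟩ →* G)
    (compat : φP.comp (inclHomOfSubset hFP x₀ hxF (hFP hxF)) =
      φQ.comp (inclHomOfSubset hFQ x₀ hxF (hFQ hxF))) :
    ∃! Φ : _root_.FundamentalGroup Y x₀ →* G,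
      Φ.comp (inclHom P x₀ (hFP hxF)) = φP ∧ Φ.comp (inclHom Q x₀ (hFQ hxF)) = φQ := by
  have hxP : x₀ ∈ P := hFP hxF
  have hxQ : x₀ ∈ Q := hFQ hxF
  have hxU : x₀ ∈ U := hPU hxP
  have hxT : x₀ ∈ T := hQT hxQ
  have hFUT : F ⊆ U ∩ T := fun y hy => ⟨hPU (hFP hy), hQT (hFQ hy)⟩
  -- Prop. 1.17 for the three deformation retracts
  have hbP := bijective_inclHomOfSubset_of_isStrongDeformationRetractOf hP hPU hxP
  have hbQ := bijective_inclHomOfSubset_of_isStrongDeformationRetractOf hQ hQT hxQ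
  have hbF := bijective_inclHomOfSubset_of_isStrongDeformationRetractOf hF hFUT hxF
  let eP : _root_.FundamentalGroup P ⟨x₀, hxP⟩ ≃* _root_.FundamentalGroup U ⟨x₀, hxU⟩ :=
    MulEquiv.ofBijective (inclHomOfSubset hPU x₀ hxP hxU) hbP
  let eQ : _root_.FundamentalGroup Q ⟨x₀, hxQ⟩ ≃* _root_.FundamentalGroup T ⟨x₀, hxT⟩ :=
    MulEquiv.ofBijective (inclHomOfSubset hQT x₀ hxQ hxT) hbQ
  have heP : ∀ a, eP a = inclHomOfSubset hPU x₀ hxP hxU a := fun _ => rfl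
  have heQ : ∀ a, eQ a = inclHomOfSubset hQT x₀ hxQ hxT a := fun _ => rfl
  -- the cone moved to the open pieces
  let φU : _root_.FundamentalGroup U ⟨x₀, hxU⟩ →* G := φP.comp eP.symm.toMonoidHom
  let φT : _root_.FundamentalGroup T ⟨x₀, hxT⟩ →* G := φQ.comp eQ.symm.toMonoidHom
  have hφU : φU.comp (inclHomOfSubset hPU x₀ hxP hxU) = φP := by
    refine MonoidHom.ext fun a => ?_
    change φP (eP.symm (inclHomOfSubset hPU x₀ hxP hxU a)) = φP a
    rw [← heP, MulEquiv.symm_apply_apply]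
  have hφT : φT.comp (inclHomOfSubset hQT x₀ hxQ hxT) = φQ := by
    refine MonoidHom.ext fun a => ?_
    change φQ (eQ.symm (inclHomOfSubset hQT x₀ hxQ hxT a)) = φQ a
    rw [← heQ, MulEquiv.symm_apply_apply]
  -- compatibility on the loops inside `U ∩ T`: they come from `π₁ F`
  have compat' : ∀ (δ : Path x₀ x₀) (hU : ∀ t, δ t ∈ U) (hT : ∀ t, δ t ∈ T),
      φU (_root_.FundamentalGroup.fromPath (Path.Homotopic.Quotient.mk (liftPath U δ hU))) =
        φT (_root_.FundamentalGroup.fromPath (Path.Homotopic.Quotient.mk (liftPath T δ hT))) := by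
    intro δ hU hT
    obtain ⟨l, hl⟩ := hbF.2 (_root_.FundamentalGroup.fromPath
      (Path.Homotopic.Quotient.mk (liftPath (U ∩ T) δ fun t => ⟨hU t, hT t⟩)))
    have hlU : _root_.FundamentalGroup.fromPath (Path.Homotopic.Quotient.mk (liftPath U δ hU)) =
        inclHomOfSubset hPU x₀ hxP hxU (inclHomOfSubset hFP x₀ hxF hxP l) := by
      rw [inclHomOfSubset_inclHomOfSubset hFP hPU hxF hxP hxU,
        ← inclHomOfSubset_inclHomOfSubset hFUT inter_subset_left hxF ⟨hxU, hxT⟩ hxU, hl,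
        inclHomOfSubset_fromPath_liftPath]
    have hlT : _root_.FundamentalGroup.fromPath (Path.Homotopic.Quotient.mk (liftPath T δ hT)) =
        inclHomOfSubset hQT x₀ hxQ hxT (inclHomOfSubset hFQ x₀ hxF hxQ l) := by
      rw [inclHomOfSubset_inclHomOfSubset hFQ hQT hxF hxQ hxT,
        ← inclHomOfSubset_inclHomOfSubset hFUT inter_subset_right hxF ⟨hxU, hxT⟩ hxT, hl,
        inclHomOfSubset_fromPath_liftPath]
    rw [hlU, hlT]
    change φU.comp (inclHomOfSubset hPU x₀ hxP hxU) (inclHomOfSubset hFP x₀ hxF hxP l) =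
      φT.comp (inclHomOfSubset hQT x₀ hxQ hxT) (inclHomOfSubset hFQ x₀ hxF hxQ l)
    rw [hφU, hφT, ← MonoidHom.comp_apply, compat, MonoidHom.comp_apply]
  -- van Kampen for the open cover
  obtain ⟨Φ, ⟨hΦU, hΦT⟩, huniq⟩ :=
    existsUnique_hom_of_cover hUo hTo hcov hxU hxT hUpc hTpc hmeet φU φT compat'
  refine ⟨Φ, ⟨?_, ?_⟩, ?_⟩
  · rw [← inclHom_comp_inclHomOfSubset hPU hxP hxU, ← MonoidHom.comp_assoc, hΦU, hφU]
  · rw [← inclHom_comp_inclHomOfSubset hQT hxQ hxT, ← MonoidHom.comp_assoc, hΦT, hφT]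
  · rintro Φ' ⟨hΦ'P, hΦ'Q⟩
    refine huniq Φ' ⟨?_, ?_⟩
    · rw [← MonoidHom.cancel_right hbP.2, MonoidHom.comp_assoc, inclHom_comp_inclHomOfSubset,
        hΦ'P, hφU]
    · rw [← MonoidHom.cancel_right hbQ.2, MonoidHom.comp_assoc, inclHom_comp_inclHomOfSubset,
        hΦ'Q, hφT]

/-- **Uniqueness half**: under the hypotheses of `existsUnique_hom_of_deformationRetracts`, two
homomorphisms out of `π₁(Y, x₀)` which agree on the images of `π₁(P, x₀)` and of `π₁(Q, x₀)`
are equal (`π₁ Y` is generated by the two images, Hatcher Lemma 1.15 with Prop. 1.17).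
[cite: HatcherAT2002, Thm. 1.20 and Prop. 1.17] -/
theorem hom_ext_of_deformationRetracts (hUo : IsOpen U) (hTo : IsOpen T)
    (hcov : U ∪ T = univ) (hUpc : IsPathConnected U) (hTpc : IsPathConnected T)
    (hmeet : IsPathConnected (U ∩ T)) (hPU : P ⊆ U) (hQT : Q ⊆ T) (hFP : F ⊆ P) (hFQ : F ⊆ Q)
    (hxF : x₀ ∈ F) (hP : Homotopy.IsStrongDeformationRetractOf P U)
    (hQ : Homotopy.IsStrongDeformationRetractOf Q T)
    (hF : Homotopy.IsStrongDeformationRetractOf F (U ∩ T))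
    {G : Type*} [Group G] {Φ Ψ : _root_.FundamentalGroup Y x₀ →* G}
    (hPeq : Φ.comp (inclHom P x₀ (hFP hxF)) = Ψ.comp (inclHom P x₀ (hFP hxF)))
    (hQeq : Φ.comp (inclHom Q x₀ (hFQ hxF)) = Ψ.comp (inclHom Q x₀ (hFQ hxF))) : Φ = Ψ := by
  have compat : (Ψ.comp (inclHom P x₀ (hFP hxF))).comp (inclHomOfSubset hFP x₀ hxF (hFP hxF)) =
      (Ψ.comp (inclHom Q x₀ (hFQ hxF))).comp (inclHomOfSubset hFQ x₀ hxF (hFQ hxF)) := by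
    rw [MonoidHom.comp_assoc, inclHom_comp_inclHomOfSubset, MonoidHom.comp_assoc,
      inclHom_comp_inclHomOfSubset]
  obtain ⟨Θ, -, huniq⟩ := existsUnique_hom_of_deformationRetracts hUo hTo hcov hUpc hTpc hmeet hPU
    hQT hFP hFQ hxF hP hQ hF _ _ compat
  exact (huniq Φ ⟨hPeq, hQeq⟩).trans (huniq Ψ ⟨rfl, rfl⟩).symm

/-- **Free-product case**: under the hypotheses of `existsUnique_hom_of_deformationRetracts`, if
`π₁(F, x₀)` is trivial (e.g. `F` a disc) then EVERY pair `φ_P : π₁(P, x₀) → G`,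
`φ_Q : π₁(Q, x₀) → G` factors (uniquely) through `π₁(Y, x₀)`: `π₁(Y) ≅ π₁(P) ∗ π₁(Q)` (Hatcher,
Thm. 1.20 with simply connected intersection). [cite: HatcherAT2002, Thm. 1.20 and Prop. 1.17] -/
theorem exists_hom_of_deformationRetracts_of_subsingleton (hUo : IsOpen U) (hTo : IsOpen T)
    (hcov : U ∪ T = univ) (hUpc : IsPathConnected U) (hTpc : IsPathConnected T)
    (hmeet : IsPathConnected (U ∩ T)) (hPU : P ⊆ U) (hQT : Q ⊆ T) (hFP : F ⊆ P) (hFQ : F ⊆ Q)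
    (hxF : x₀ ∈ F) (hP : Homotopy.IsStrongDeformationRetractOf P U)
    (hQ : Homotopy.IsStrongDeformationRetractOf Q T)
    (hF : Homotopy.IsStrongDeformationRetractOf F (U ∩ T))
    [Subsingleton (_root_.FundamentalGroup F ⟨x₀, hxF⟩)]
    {G : Type*} [Group G] (φP : _root_.FundamentalGroup P ⟨x₀, hFP hxF⟩ →* G)
    (φQ : _root_.FundamentalGroup Q ⟨x₀, hFQ hxF⟩ →* G) :
    ∃ Φ : _root_.FundamentalGroup Y x₀ →* G,
      Φ.comp (inclHom P x₀ (hFP hxF)) = φP ∧ Φ.comp (inclHom Q x₀ (hFQ hxF)) = φQ := by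
  have compat : φP.comp (inclHomOfSubset hFP x₀ hxF (hFP hxF)) =
      φQ.comp (inclHomOfSubset hFQ x₀ hxF (hFQ hxF)) :=
    MonoidHom.ext fun a => by rw [Subsingleton.elim a 1, map_one, map_one]
  exact (existsUnique_hom_of_deformationRetracts hUo hTo hcov hUpc hTpc hmeet hPU hQT hFP hFQ hxF
    hP hQ hF φP φQ compat).exists

end ClosedPieces

/-! ### Closed cover with collars -/

section ClosedCover

variable {X : Type*} [TopologicalSpace X]

/-- **Seifert–van Kampen for two closed pieces meeting along a two-sidedly collared subset,
universal-property form.**  Let `R₁, R₂ ⊆ X` be closed with `R₁ ∩ R₂ = F ∋ x₀`; let `F ⊆ C_a ⊆ R_a`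
(`a = 1, 2`) be open in `R_a` (`C_a = R_a ∩ O_a` with `O_a` open) and strong deformation retract
onto `F`; let `R₁`, `R₂`, `F` be path connected.  Then for every group `G` and homomorphisms
`φ_a : π₁(R_a, x₀) → G` with `φ₁ ∘ (F ⊆ R₁)_* = φ₂ ∘ (F ⊆ R₂)_*` there is a unique
`Φ : π₁(R₁ ∪ R₂, x₀) → G` with `Φ ∘ (R_a ⊆ R₁ ∪ R₂)_* = φ_a` (`a = 1, 2`):
`π₁(R₁ ∪ R₂) ≅ π₁(R₁) *_{π₁(F)} π₁(R₂)` (Hatcher, Thm. 1.20 for the open neighbourhoods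
`R₁ ∪ C₂`, `R₂ ∪ C₁`, which deformation retract onto `R₁`, `R₂`, with intersection `C₁ ∪ C₂`
deformation retracting onto `F`).  E.g. a closed surface cut along a separating circle, two
`3`-manifolds glued along a disc in their boundaries.
[cite: HatcherAT2002, Thm. 1.20 and Prop. 1.17] -/
theorem existsUnique_hom_of_closed_cover_collars {R₁ R₂ F C₁ C₂ O₁ O₂ : Set X}
    (hR₁ : IsClosed R₁) (hR₂ : IsClosed R₂) (hFR₁ : F ⊆ R₁) (hFR₂ : F ⊆ R₂) (hF : R₁ ∩ R₂ ⊆ F)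
    (hO₁ : IsOpen O₁) (hC₁ : C₁ = R₁ ∩ O₁) (hFC₁ : F ⊆ C₁)
    (hO₂ : IsOpen O₂) (hC₂ : C₂ = R₂ ∩ O₂) (hFC₂ : F ⊆ C₂)
    (hsdr₁ : Homotopy.IsStrongDeformationRetractOf F C₁)
    (hsdr₂ : Homotopy.IsStrongDeformationRetractOf F C₂)
    (hR₁pc : IsPathConnected R₁) (hR₂pc : IsPathConnected R₂) (hFpc : IsPathConnected F)
    {x₀ : X} (hx₀ : x₀ ∈ F) {G : Type*} [Group G]
    (φ₁ : _root_.FundamentalGroup R₁ ⟨x₀, hFR₁ hx₀⟩ →* G)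
    (φ₂ : _root_.FundamentalGroup R₂ ⟨x₀, hFR₂ hx₀⟩ →* G)
    (compat : φ₁.comp (inclHomOfSubset hFR₁ x₀ hx₀ (hFR₁ hx₀)) =
      φ₂.comp (inclHomOfSubset hFR₂ x₀ hx₀ (hFR₂ hx₀))) :
    ∃! Φ : _root_.FundamentalGroup ↥(R₁ ∪ R₂)
        ⟨x₀, (hFR₁.trans subset_union_left : F ⊆ R₁ ∪ R₂) hx₀⟩ →* G,
      Φ.comp (inclHomOfSubset (subset_union_left : R₁ ⊆ R₁ ∪ R₂) x₀ (hFR₁ hx₀)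
          ((hFR₁.trans subset_union_left : F ⊆ R₁ ∪ R₂) hx₀)) = φ₁ ∧
        Φ.comp (inclHomOfSubset (subset_union_right : R₂ ⊆ R₁ ∪ R₂) x₀ (hFR₂ hx₀)
          ((hFR₁.trans subset_union_left : F ⊆ R₁ ∪ R₂) hx₀)) = φ₂ := by
  -- notation in the subspace `Y = ↥(R₁ ∪ R₂)` (verbatim from the epimorphic form)
  have hC₁R₁ : C₁ ⊆ R₁ := fun x hx => (hC₁ ▸ hx : x ∈ R₁ ∩ O₁).1
  have hC₂R₂ : C₂ ⊆ R₂ := fun x hx => (hC₂ ▸ hx : x ∈ R₂ ∩ O₂).1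
  have hW : F ⊆ R₁ ∪ R₂ := hFR₁.trans subset_union_left
  set P : Set ↥(R₁ ∪ R₂) := Subtype.val ⁻¹' R₁ with hP
  set Q : Set ↥(R₁ ∪ R₂) := Subtype.val ⁻¹' R₂ with hQ
  set F' : Set ↥(R₁ ∪ R₂) := Subtype.val ⁻¹' F with hF'
  set C₁' : Set ↥(R₁ ∪ R₂) := Subtype.val ⁻¹' C₁ with hC₁'
  set C₂' : Set ↥(R₁ ∪ R₂) := Subtype.val ⁻¹' C₂ with hC₂'
  have hPcl : IsClosed P := hR₁.preimage continuous_subtype_val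
  have hQcl : IsClosed Q := hR₂.preimage continuous_subtype_val
  have hPQ : P ∩ Q ⊆ F' := fun y hy => hF hy
  have hF'P : F' ⊆ P := fun y hy => hFR₁ hy
  have hF'Q : F' ⊆ Q := fun y hy => hFR₂ hy
  have hF'C₁ : F' ⊆ C₁' := fun y hy => hFC₁ hy
  have hF'C₂ : F' ⊆ C₂' := fun y hy => hFC₂ hy
  have hC₁P : C₁' ⊆ P := fun y hy => hC₁R₁ hy
  have hC₂Q : C₂' ⊆ Q := fun y hy => hC₂R₂ hy
  have hcovPQ : P ∪ Q = univ := eq_univ_of_forall fun y => y.2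
  -- the open neighbourhoods `U = P ∪ C₂'`, `T = Q ∪ C₁'`
  set U : Set ↥(R₁ ∪ R₂) := P ∪ C₂' with hU
  set T : Set ↥(R₁ ∪ R₂) := Q ∪ C₁' with hT
  have hUo : IsOpen U := by
    have : U = (Subtype.val ⁻¹' (R₂ \ O₂))ᶜ := by
      ext y
      simp only [hU, hP, hC₂', mem_union, mem_preimage, mem_compl_iff, mem_sdiff, not_and,
        not_not, hC₂, mem_inter_iff]
      constructor
      · rintro (hy | ⟨-, hy⟩) hy₂
        · exact (hC₂ ▸ hFC₂ (hF ⟨hy, hy₂⟩) : (y : X) ∈ R₂ ∩ O₂).2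
        · exact hy
      · intro h
        rcases y.2 with hy | hy
        · exact Or.inl hy
        · exact Or.inr ⟨hy, h hy⟩
    rw [this]
    exact ((hR₂.sdiff hO₂).preimage continuous_subtype_val).isOpen_compl
  have hTo : IsOpen T := by
    have : T = (Subtype.val ⁻¹' (R₁ \ O₁))ᶜ := by
      ext y
      simp only [hT, hQ, hC₁', mem_union, mem_preimage, mem_compl_iff, mem_sdiff, not_and,
        not_not, hC₁, mem_inter_iff]
      constructor
      · rintro (hy | ⟨-, hy⟩) hy₁
        · exact (hC₁ ▸ hFC₁ (hF ⟨hy₁, hy⟩) : (y : X) ∈ R₁ ∩ O₁).2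
        · exact hy
      · intro h
        rcases y.2 with hy | hy
        · exact Or.inr ⟨hy, h hy⟩
        · exact Or.inl hy
    rw [this]
    exact ((hR₁.sdiff hO₁).preimage continuous_subtype_val).isOpen_compl
  have hcov : U ∪ T = univ := by
    rw [← univ_subset_iff, ← hcovPQ]
    exact union_subset (subset_union_left.trans subset_union_left)
      (subset_union_left.trans subset_union_right)
  have hPU : P ⊆ U := subset_union_left
  have hQT : Q ⊆ T := subset_union_left
  -- the deformation retractions
  have hsdr₁' : Homotopy.IsStrongDeformationRetractOf F' C₁' :=
    hsdr₁.preimage_val (hC₁R₁.trans subset_union_left)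
  have hsdr₂' : Homotopy.IsStrongDeformationRetractOf F' C₂' :=
    hsdr₂.preimage_val (hC₂R₂.trans subset_union_right)
  have hPsdr : Homotopy.IsStrongDeformationRetractOf P U :=
    hsdr₂'.union_of_isClosed hPcl hQcl hPQ hF'P hF'C₂ hC₂Q
  have hQsdr : Homotopy.IsStrongDeformationRetractOf Q T :=
    hsdr₁'.union_of_isClosed hQcl hPcl (fun y hy => hPQ ⟨hy.2, hy.1⟩) hF'Q hF'C₁ hC₁P
  have hUT : U ∩ T = C₁' ∪ C₂' := by
    apply Subset.antisymm
    · rintro y ⟨hyU | hyU, hyT | hyT⟩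
      · exact Or.inl (hF'C₁ (hPQ ⟨hyU, hyT⟩))
      · exact Or.inl hyT
      · exact Or.inr hyU
      · exact Or.inr hyU
    · rintro y (hy | hy)
      · exact ⟨hPU (hC₁P hy), Or.inr hy⟩
      · exact ⟨Or.inr hy, hQT (hC₂Q hy)⟩
  have hFsdr : Homotopy.IsStrongDeformationRetractOf F' (U ∩ T) := by
    rw [hUT]
    have h1 : Homotopy.IsStrongDeformationRetractOf C₁' (C₁' ∪ C₂') := by
      refine hsdr₂'.union_of_inter_subset (fun y hy => hPQ ⟨hC₁P hy.1, hC₂Q hy.2⟩)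
        (fun y hy => hF'C₁ hy.1) (fun y hy => ?_) (fun y hy => ?_)
      · exact hF'C₁ (hPQ ⟨hPcl.closure_subset_iff.2 hC₁P hy.1, hC₂Q hy.2⟩)
      · exact hF'C₂ (hPQ ⟨hC₁P hy.2, hQcl.closure_subset_iff.2 hC₂Q hy.1⟩)
    exact h1.trans hsdr₁' subset_union_left hF'C₁
  -- path connectivity
  have hPpc : IsPathConnected P := hR₁pc.preimage_coe subset_union_left
  have hQpc : IsPathConnected Q := hR₂pc.preimage_coe subset_union_right
  have hF'pc : IsPathConnected F' := hFpc.preimage_coe hW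
  have hUpc : IsPathConnected U := hPsdr.isPathConnected (by rwa [inter_eq_left.2 hPU])
  have hTpc : IsPathConnected T := hQsdr.isPathConnected (by rwa [inter_eq_left.2 hQT])
  have hF'UT : F' ⊆ U ∩ T := fun y hy => ⟨hPU (hF'P hy), hQT (hF'Q hy)⟩
  have hmeet : IsPathConnected (U ∩ T) :=
    hFsdr.isPathConnected (by rwa [inter_eq_left.2 hF'UT])
  -- the subspace bookkeeping
  obtain ⟨θF, -, hθB⟩ := exists_mulEquiv_preimageVal_forall_comm hW hx₀
  obtain ⟨θ₁, hθ₁W, hθ₁⟩ := hθB hFR₁ subset_union_left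
  obtain ⟨θ₂, hθ₂W, hθ₂⟩ := hθB hFR₂ subset_union_right
  have hxF' : (⟨x₀, hW hx₀⟩ : ↥(R₁ ∪ R₂)) ∈ F' := hx₀
  -- the cone moved to the subspace pieces
  let φP : _root_.FundamentalGroup P ⟨⟨x₀, hW hx₀⟩, hF'P hxF'⟩ →* G := φ₁.comp θ₁.symm.toMonoidHom
  let φQ : _root_.FundamentalGroup Q ⟨⟨x₀, hW hx₀⟩, hF'Q hxF'⟩ →* G := φ₂.comp θ₂.symm.toMonoidHom
  have hφP : φP.comp θ₁.toMonoidHom = φ₁ :=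
    MonoidHom.ext fun a => by simp [φP]
  have hφQ : φQ.comp θ₂.toMonoidHom = φ₂ :=
    MonoidHom.ext fun a => by simp [φQ]
  have hθ₁c : (inclHomOfSubset hF'P _ hxF' (hF'P hxF')).comp θF.toMonoidHom =
      θ₁.toMonoidHom.comp (inclHomOfSubset hFR₁ x₀ hx₀ (hFR₁ hx₀)) :=
    MonoidHom.ext fun a => hθ₁ a
  have hθ₂c : (inclHomOfSubset hF'Q _ hxF' (hF'Q hxF')).comp θF.toMonoidHom =
      θ₂.toMonoidHom.comp (inclHomOfSubset hFR₂ x₀ hx₀ (hFR₂ hx₀)) :=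
    MonoidHom.ext fun a => hθ₂ a
  have compat' : φP.comp (inclHomOfSubset hF'P _ hxF' (hF'P hxF')) =
      φQ.comp (inclHomOfSubset hF'Q _ hxF' (hF'Q hxF')) := by
    have hθFs : Function.Surjective θF.toMonoidHom := θF.surjective
    rw [← MonoidHom.cancel_right hθFs]
    change (φP.comp (inclHomOfSubset hF'P _ hxF' (hF'P hxF'))).comp θF.toMonoidHom =
      (φQ.comp (inclHomOfSubset hF'Q _ hxF' (hF'Q hxF'))).comp θF.toMonoidHom
    rw [MonoidHom.comp_assoc, hθ₁c, ← MonoidHom.comp_assoc, hφP, MonoidHom.comp_assoc, hθ₂c,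
      ← MonoidHom.comp_assoc, hφQ, compat]
  have hθ₁W' : (inclHom P ⟨x₀, hW hx₀⟩ (hF'P hxF')).comp θ₁.toMonoidHom =
      inclHomOfSubset (subset_union_left : R₁ ⊆ R₁ ∪ R₂) x₀ (hFR₁ hx₀) (hW hx₀) :=
    MonoidHom.ext fun b => hθ₁W b
  have hθ₂W' : (inclHom Q ⟨x₀, hW hx₀⟩ (hF'Q hxF')).comp θ₂.toMonoidHom =
      inclHomOfSubset (subset_union_right : R₂ ⊆ R₁ ∪ R₂) x₀ (hFR₂ hx₀) (hW hx₀) :=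
    MonoidHom.ext fun b => hθ₂W b
  -- van Kampen in the subspace
  obtain ⟨Φ, ⟨hΦP, hΦQ⟩, huniq⟩ := existsUnique_hom_of_deformationRetracts hUo hTo hcov hUpc hTpc
    hmeet hPU hQT hF'P hF'Q hxF' hPsdr hQsdr hFsdr φP φQ compat'
  refine ⟨Φ, ⟨?_, ?_⟩, ?_⟩
  · rw [← hθ₁W', ← MonoidHom.comp_assoc, hΦP, hφP]
  · rw [← hθ₂W', ← MonoidHom.comp_assoc, hΦQ, hφQ]
  · rintro Φ' ⟨hΦ'₁, hΦ'₂⟩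
    refine huniq Φ' ⟨?_, ?_⟩
    · have hθ₁s : Function.Surjective θ₁.toMonoidHom := θ₁.surjective
      rw [← MonoidHom.cancel_right hθ₁s]
      change (Φ'.comp (inclHom P ⟨x₀, hW hx₀⟩ (hF'P hxF'))).comp θ₁.toMonoidHom =
        φP.comp θ₁.toMonoidHom
      rw [MonoidHom.comp_assoc, hθ₁W', hΦ'₁, hφP]
    · have hθ₂s : Function.Surjective θ₂.toMonoidHom := θ₂.surjective
      rw [← MonoidHom.cancel_right hθ₂s]
      change (Φ'.comp (inclHom Q ⟨x₀, hW hx₀⟩ (hF'Q hxF'))).comp θ₂.toMonoidHom =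
        φQ.comp θ₂.toMonoidHom
      rw [MonoidHom.comp_assoc, hθ₂W', hΦ'₂, hφQ]

/-- **Uniqueness half** of `existsUnique_hom_of_closed_cover_collars`: two homomorphisms out of
`π₁(R₁ ∪ R₂, x₀)` which agree on the images of `π₁(R₁, x₀)` and `π₁(R₂, x₀)` are equal.
[cite: HatcherAT2002, Thm. 1.20 and Prop. 1.17] -/
theorem hom_ext_of_closed_cover_collars {R₁ R₂ F C₁ C₂ O₁ O₂ : Set X}
    (hR₁ : IsClosed R₁) (hR₂ : IsClosed R₂) (hFR₁ : F ⊆ R₁) (hFR₂ : F ⊆ R₂) (hF : R₁ ∩ R₂ ⊆ F)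
    (hO₁ : IsOpen O₁) (hC₁ : C₁ = R₁ ∩ O₁) (hFC₁ : F ⊆ C₁)
    (hO₂ : IsOpen O₂) (hC₂ : C₂ = R₂ ∩ O₂) (hFC₂ : F ⊆ C₂)
    (hsdr₁ : Homotopy.IsStrongDeformationRetractOf F C₁)
    (hsdr₂ : Homotopy.IsStrongDeformationRetractOf F C₂)
    (hR₁pc : IsPathConnected R₁) (hR₂pc : IsPathConnected R₂) (hFpc : IsPathConnected F)
    {x₀ : X} (hx₀ : x₀ ∈ F) {G : Type*} [Group G]
    {Φ Ψ : _root_.FundamentalGroup ↥(R₁ ∪ R₂)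
        ⟨x₀, (hFR₁.trans subset_union_left : F ⊆ R₁ ∪ R₂) hx₀⟩ →* G}
    (h₁ : Φ.comp (inclHomOfSubset (subset_union_left : R₁ ⊆ R₁ ∪ R₂) x₀ (hFR₁ hx₀)
          ((hFR₁.trans subset_union_left : F ⊆ R₁ ∪ R₂) hx₀)) =
        Ψ.comp (inclHomOfSubset (subset_union_left : R₁ ⊆ R₁ ∪ R₂) x₀ (hFR₁ hx₀)
          ((hFR₁.trans subset_union_left : F ⊆ R₁ ∪ R₂) hx₀)))
    (h₂ : Φ.comp (inclHomOfSubset (subset_union_right : R₂ ⊆ R₁ ∪ R₂) x₀ (hFR₂ hx₀)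
          ((hFR₁.trans subset_union_left : F ⊆ R₁ ∪ R₂) hx₀)) =
        Ψ.comp (inclHomOfSubset (subset_union_right : R₂ ⊆ R₁ ∪ R₂) x₀ (hFR₂ hx₀)
          ((hFR₁.trans subset_union_left : F ⊆ R₁ ∪ R₂) hx₀))) : Φ = Ψ := by
  have hW : F ⊆ R₁ ∪ R₂ := hFR₁.trans subset_union_left
  have compat : (Ψ.comp (inclHomOfSubset (subset_union_left : R₁ ⊆ R₁ ∪ R₂) x₀ (hFR₁ hx₀)
        (hW hx₀))).comp (inclHomOfSubset hFR₁ x₀ hx₀ (hFR₁ hx₀)) =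
      (Ψ.comp (inclHomOfSubset (subset_union_right : R₂ ⊆ R₁ ∪ R₂) x₀ (hFR₂ hx₀)
        (hW hx₀))).comp (inclHomOfSubset hFR₂ x₀ hx₀ (hFR₂ hx₀)) := by
    rw [MonoidHom.comp_assoc, inclHomOfSubset_comp, MonoidHom.comp_assoc, inclHomOfSubset_comp]
  obtain ⟨Θ, -, huniq⟩ := existsUnique_hom_of_closed_cover_collars hR₁ hR₂ hFR₁ hFR₂ hF hO₁ hC₁
    hFC₁ hO₂ hC₂ hFC₂ hsdr₁ hsdr₂ hR₁pc hR₂pc hFpc hx₀ _ _ compat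
  exact (huniq Φ ⟨h₁, h₂⟩).trans (huniq Ψ ⟨rfl, rfl⟩).symm

/-- **Free-product case** of `existsUnique_hom_of_closed_cover_collars`: if `π₁(F, x₀)` is
trivial (e.g. `F` a disc along which two `3`-manifolds are glued), every pair
`φ_a : π₁(R_a, x₀) → G` factors (uniquely) through `π₁(R₁ ∪ R₂, x₀)` — the universal property of
the free product `π₁(R₁) ∗ π₁(R₂)`. [cite: HatcherAT2002, Thm. 1.20 and Prop. 1.17] -/
theorem exists_hom_of_closed_cover_collars_of_subsingleton {R₁ R₂ F C₁ C₂ O₁ O₂ : Set X}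
    (hR₁ : IsClosed R₁) (hR₂ : IsClosed R₂) (hFR₁ : F ⊆ R₁) (hFR₂ : F ⊆ R₂) (hF : R₁ ∩ R₂ ⊆ F)
    (hO₁ : IsOpen O₁) (hC₁ : C₁ = R₁ ∩ O₁) (hFC₁ : F ⊆ C₁)
    (hO₂ : IsOpen O₂) (hC₂ : C₂ = R₂ ∩ O₂) (hFC₂ : F ⊆ C₂)
    (hsdr₁ : Homotopy.IsStrongDeformationRetractOf F C₁)
    (hsdr₂ : Homotopy.IsStrongDeformationRetractOf F C₂)
    (hR₁pc : IsPathConnected R₁) (hR₂pc : IsPathConnected R₂) (hFpc : IsPathConnected F)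
    {x₀ : X} (hx₀ : x₀ ∈ F) [Subsingleton (_root_.FundamentalGroup F ⟨x₀, hx₀⟩)]
    {G : Type*} [Group G]
    (φ₁ : _root_.FundamentalGroup R₁ ⟨x₀, hFR₁ hx₀⟩ →* G)
    (φ₂ : _root_.FundamentalGroup R₂ ⟨x₀, hFR₂ hx₀⟩ →* G) :
    ∃ Φ : _root_.FundamentalGroup ↥(R₁ ∪ R₂)
        ⟨x₀, (hFR₁.trans subset_union_left : F ⊆ R₁ ∪ R₂) hx₀⟩ →* G,
      Φ.comp (inclHomOfSubset (subset_union_left : R₁ ⊆ R₁ ∪ R₂) x₀ (hFR₁ hx₀)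
          ((hFR₁.trans subset_union_left : F ⊆ R₁ ∪ R₂) hx₀)) = φ₁ ∧
        Φ.comp (inclHomOfSubset (subset_union_right : R₂ ⊆ R₁ ∪ R₂) x₀ (hFR₂ hx₀)
          ((hFR₁.trans subset_union_left : F ⊆ R₁ ∪ R₂) hx₀)) = φ₂ := by
  have compat : φ₁.comp (inclHomOfSubset hFR₁ x₀ hx₀ (hFR₁ hx₀)) =
      φ₂.comp (inclHomOfSubset hFR₂ x₀ hx₀ (hFR₂ hx₀)) :=
    MonoidHom.ext fun a => by rw [Subsingleton.elim a 1, map_one, map_one]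
  exact (existsUnique_hom_of_closed_cover_collars hR₁ hR₂ hFR₁ hFR₂ hF hO₁ hC₁ hFC₁ hO₂ hC₂ hFC₂
    hsdr₁ hsdr₂ hR₁pc hR₂pc hFpc hx₀ φ₁ φ₂ compat).exists

/-- **Generation** for a closed cover with collars (Hatcher, Lemma 1.15 with Prop. 1.17): under
the hypotheses of `existsUnique_hom_of_closed_cover_collars`, `π₁(R₁ ∪ R₂, x₀)` is generated by
the images of `π₁(R₁, x₀)` and `π₁(R₂, x₀)`. [cite: HatcherAT2002, Lemma 1.15 and Prop. 1.17] -/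
theorem closure_range_union_eq_top_of_closed_cover_collars {R₁ R₂ F C₁ C₂ O₁ O₂ : Set X}
    (hR₁ : IsClosed R₁) (hR₂ : IsClosed R₂) (hFR₁ : F ⊆ R₁) (hFR₂ : F ⊆ R₂) (hF : R₁ ∩ R₂ ⊆ F)
    (hO₁ : IsOpen O₁) (hC₁ : C₁ = R₁ ∩ O₁) (hFC₁ : F ⊆ C₁)
    (hO₂ : IsOpen O₂) (hC₂ : C₂ = R₂ ∩ O₂) (hFC₂ : F ⊆ C₂)
    (hsdr₁ : Homotopy.IsStrongDeformationRetractOf F C₁)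
    (hsdr₂ : Homotopy.IsStrongDeformationRetractOf F C₂)
    (hR₁pc : IsPathConnected R₁) (hR₂pc : IsPathConnected R₂) (hFpc : IsPathConnected F)
    {x₀ : X} (hx₀ : x₀ ∈ F) :
    Subgroup.closure
        (Set.range (inclHomOfSubset (subset_union_left : R₁ ⊆ R₁ ∪ R₂) x₀ (hFR₁ hx₀)
            ((hFR₁.trans subset_union_left : F ⊆ R₁ ∪ R₂) hx₀)) ∪
          Set.range (inclHomOfSubset (subset_union_right : R₂ ⊆ R₁ ∪ R₂) x₀ (hFR₂ hx₀)
            ((hFR₁.trans subset_union_left : F ⊆ R₁ ∪ R₂) hx₀))) = ⊤ := by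
  -- Hatcher's generation for the open neighbourhoods `U = R₁ ∪ C₂`, `T = R₂ ∪ C₁` (set up verbatim
  -- as in `existsUnique_hom_of_closed_cover_collars`), transported: the ranges of `π₁ R_a` and of
  -- `π₁ U_a` in `π₁(R₁ ∪ R₂)` agree by Prop. 1.17.
  have hC₁R₁ : C₁ ⊆ R₁ := fun x hx => (hC₁ ▸ hx : x ∈ R₁ ∩ O₁).1
  have hC₂R₂ : C₂ ⊆ R₂ := fun x hx => (hC₂ ▸ hx : x ∈ R₂ ∩ O₂).1
  have hW : F ⊆ R₁ ∪ R₂ := hFR₁.trans subset_union_left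
  set P : Set ↥(R₁ ∪ R₂) := Subtype.val ⁻¹' R₁ with hP
  set Q : Set ↥(R₁ ∪ R₂) := Subtype.val ⁻¹' R₂ with hQ
  set F' : Set ↥(R₁ ∪ R₂) := Subtype.val ⁻¹' F with hF'
  set C₁' : Set ↥(R₁ ∪ R₂) := Subtype.val ⁻¹' C₁ with hC₁'
  set C₂' : Set ↥(R₁ ∪ R₂) := Subtype.val ⁻¹' C₂ with hC₂'
  have hPcl : IsClosed P := hR₁.preimage continuous_subtype_val
  have hQcl : IsClosed Q := hR₂.preimage continuous_subtype_val
  have hPQ : P ∩ Q ⊆ F' := fun y hy => hF hy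
  have hF'P : F' ⊆ P := fun y hy => hFR₁ hy
  have hF'Q : F' ⊆ Q := fun y hy => hFR₂ hy
  have hF'C₁ : F' ⊆ C₁' := fun y hy => hFC₁ hy
  have hF'C₂ : F' ⊆ C₂' := fun y hy => hFC₂ hy
  have hC₁P : C₁' ⊆ P := fun y hy => hC₁R₁ hy
  have hC₂Q : C₂' ⊆ Q := fun y hy => hC₂R₂ hy
  have hcovPQ : P ∪ Q = univ := eq_univ_of_forall fun y => y.2
  set U : Set ↥(R₁ ∪ R₂) := P ∪ C₂' with hU
  set T : Set ↥(R₁ ∪ R₂) := Q ∪ C₁' with hT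
  have hUo : IsOpen U := by
    have : U = (Subtype.val ⁻¹' (R₂ \ O₂))ᶜ := by
      ext y
      simp only [hU, hP, hC₂', mem_union, mem_preimage, mem_compl_iff, mem_sdiff, not_and,
        not_not, hC₂, mem_inter_iff]
      constructor
      · rintro (hy | ⟨-, hy⟩) hy₂
        · exact (hC₂ ▸ hFC₂ (hF ⟨hy, hy₂⟩) : (y : X) ∈ R₂ ∩ O₂).2
        · exact hy
      · intro h
        rcases y.2 with hy | hy
        · exact Or.inl hy
        · exact Or.inr ⟨hy, h hy⟩
    rw [this]
    exact ((hR₂.sdiff hO₂).preimage continuous_subtype_val).isOpen_compl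
  have hTo : IsOpen T := by
    have : T = (Subtype.val ⁻¹' (R₁ \ O₁))ᶜ := by
      ext y
      simp only [hT, hQ, hC₁', mem_union, mem_preimage, mem_compl_iff, mem_sdiff, not_and,
        not_not, hC₁, mem_inter_iff]
      constructor
      · rintro (hy | ⟨-, hy⟩) hy₁
        · exact (hC₁ ▸ hFC₁ (hF ⟨hy₁, hy⟩) : (y : X) ∈ R₁ ∩ O₁).2
        · exact hy
      · intro h
        rcases y.2 with hy | hy
        · exact Or.inr ⟨hy, h hy⟩
        · exact Or.inl hy
    rw [this]
    exact ((hR₁.sdiff hO₁).preimage continuous_subtype_val).isOpen_compl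
  have hcov : U ∪ T = univ := by
    rw [← univ_subset_iff, ← hcovPQ]
    exact union_subset (subset_union_left.trans subset_union_left)
      (subset_union_left.trans subset_union_right)
  have hPU : P ⊆ U := subset_union_left
  have hQT : Q ⊆ T := subset_union_left
  have hsdr₁' : Homotopy.IsStrongDeformationRetractOf F' C₁' :=
    hsdr₁.preimage_val (hC₁R₁.trans subset_union_left)
  have hsdr₂' : Homotopy.IsStrongDeformationRetractOf F' C₂' :=
    hsdr₂.preimage_val (hC₂R₂.trans subset_union_right)
  have hPsdr : Homotopy.IsStrongDeformationRetractOf P U :=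
    hsdr₂'.union_of_isClosed hPcl hQcl hPQ hF'P hF'C₂ hC₂Q
  have hQsdr : Homotopy.IsStrongDeformationRetractOf Q T :=
    hsdr₁'.union_of_isClosed hQcl hPcl (fun y hy => hPQ ⟨hy.2, hy.1⟩) hF'Q hF'C₁ hC₁P
  have hUT : U ∩ T = C₁' ∪ C₂' := by
    apply Subset.antisymm
    · rintro y ⟨hyU | hyU, hyT | hyT⟩
      · exact Or.inl (hF'C₁ (hPQ ⟨hyU, hyT⟩))
      · exact Or.inl hyT
      · exact Or.inr hyU
      · exact Or.inr hyU
    · rintro y (hy | hy)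
      · exact ⟨hPU (hC₁P hy), Or.inr hy⟩
      · exact ⟨Or.inr hy, hQT (hC₂Q hy)⟩
  have hFsdr : Homotopy.IsStrongDeformationRetractOf F' (U ∩ T) := by
    rw [hUT]
    have h1 : Homotopy.IsStrongDeformationRetractOf C₁' (C₁' ∪ C₂') := by
      refine hsdr₂'.union_of_inter_subset (fun y hy => hPQ ⟨hC₁P hy.1, hC₂Q hy.2⟩)
        (fun y hy => hF'C₁ hy.1) (fun y hy => ?_) (fun y hy => ?_)
      · exact hF'C₁ (hPQ ⟨hPcl.closure_subset_iff.2 hC₁P hy.1, hC₂Q hy.2⟩)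
      · exact hF'C₂ (hPQ ⟨hC₁P hy.2, hQcl.closure_subset_iff.2 hC₂Q hy.1⟩)
    exact h1.trans hsdr₁' subset_union_left hF'C₁
  have hPpc : IsPathConnected P := hR₁pc.preimage_coe subset_union_left
  have hQpc : IsPathConnected Q := hR₂pc.preimage_coe subset_union_right
  have hF'pc : IsPathConnected F' := hFpc.preimage_coe hW
  have hUpc : IsPathConnected U := hPsdr.isPathConnected (by rwa [inter_eq_left.2 hPU])
  have hTpc : IsPathConnected T := hQsdr.isPathConnected (by rwa [inter_eq_left.2 hQT])
  have hF'UT : F' ⊆ U ∩ T := fun y hy => ⟨hPU (hF'P hy), hQT (hF'Q hy)⟩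
  have hmeet : IsPathConnected (U ∩ T) :=
    hFsdr.isPathConnected (by rwa [inter_eq_left.2 hF'UT])
  have hxF' : (⟨x₀, hW hx₀⟩ : ↥(R₁ ∪ R₂)) ∈ F' := hx₀
  have hxP : (⟨x₀, hW hx₀⟩ : ↥(R₁ ∪ R₂)) ∈ P := hF'P hxF'
  have hxQ : (⟨x₀, hW hx₀⟩ : ↥(R₁ ∪ R₂)) ∈ Q := hF'Q hxF'
  have hxU : (⟨x₀, hW hx₀⟩ : ↥(R₁ ∪ R₂)) ∈ U := hPU hxP
  have hxT : (⟨x₀, hW hx₀⟩ : ↥(R₁ ∪ R₂)) ∈ T := hQT hxQ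
  -- generation for the open cover
  have hgen := closure_range_inclHom_union_eq_top hUo hTo hcov hxU hxT hUpc hTpc hmeet
  -- the ranges of `π₁ P → π₁ Y`, `π₁ U → π₁ Y` agree (Prop. 1.17), and likewise for `Q`, `T`
  have hbP := bijective_inclHomOfSubset_of_isStrongDeformationRetractOf hPsdr hPU hxP
  have hbQ := bijective_inclHomOfSubset_of_isStrongDeformationRetractOf hQsdr hQT hxQ
  have hrP : Set.range (inclHom U _ hxU) = Set.range (inclHom P _ hxP) := by
    rw [← inclHom_comp_inclHomOfSubset hPU hxP hxU, MonoidHom.coe_comp, Set.range_comp,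
      hbP.2.range_eq, Set.image_univ]
  have hrQ : Set.range (inclHom T _ hxT) = Set.range (inclHom Q _ hxQ) := by
    rw [← inclHom_comp_inclHomOfSubset hQT hxQ hxT, MonoidHom.coe_comp, Set.range_comp,
      hbQ.2.range_eq, Set.image_univ]
  -- the subspace bookkeeping
  obtain ⟨θF, -, hθB⟩ := exists_mulEquiv_preimageVal_forall_comm hW hx₀
  obtain ⟨θ₁, hθ₁W, -⟩ := hθB hFR₁ subset_union_left
  obtain ⟨θ₂, hθ₂W, -⟩ := hθB hFR₂ subset_union_right
  have hr₁ : Set.range (inclHomOfSubset (subset_union_left : R₁ ⊆ R₁ ∪ R₂) x₀ (hFR₁ hx₀) (hW hx₀)) =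
      Set.range (inclHom P _ hxP) := by
    ext c
    constructor
    · rintro ⟨b, rfl⟩
      exact ⟨θ₁ b, hθ₁W b⟩
    · rintro ⟨a, rfl⟩
      exact ⟨θ₁.symm a, by rw [← hθ₁W, MulEquiv.apply_symm_apply]⟩
  have hr₂ : Set.range (inclHomOfSubset (subset_union_right : R₂ ⊆ R₁ ∪ R₂) x₀ (hFR₂ hx₀) (hW hx₀)) =
      Set.range (inclHom Q _ hxQ) := by
    ext c
    constructor
    · rintro ⟨b, rfl⟩
      exact ⟨θ₂ b, hθ₂W b⟩
    · rintro ⟨a, rfl⟩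
      exact ⟨θ₂.symm a, by rw [← hθ₂W, MulEquiv.apply_symm_apply]⟩
  rw [hr₁, hr₂, ← hrP, ← hrQ]
  exact hgen

/-- **Attaching a simply connected piece** (closed cover with collars, `π₁(R₂, x₀) = 1`): the map
`π₁(R₁, x₀) → π₁(R₁ ∪ R₂, x₀)` is surjective and its kernel is the normal closure of the image of
`π₁(F, x₀) → π₁(R₁, x₀)` (Hatcher, Thm. 1.20 with `π₁ R₂ = 1`; e.g. capping a boundary circle of
a surface with a disc, Prop. 1.26 (a), or filling a sphere with a ball).
[cite: HatcherAT2002, Thm. 1.20 and Prop. 1.26] -/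
theorem surjective_and_ker_eq_of_closed_cover_collars_of_subsingleton_right
    {R₁ R₂ F C₁ C₂ O₁ O₂ : Set X}
    (hR₁ : IsClosed R₁) (hR₂ : IsClosed R₂) (hFR₁ : F ⊆ R₁) (hFR₂ : F ⊆ R₂) (hF : R₁ ∩ R₂ ⊆ F)
    (hO₁ : IsOpen O₁) (hC₁ : C₁ = R₁ ∩ O₁) (hFC₁ : F ⊆ C₁)
    (hO₂ : IsOpen O₂) (hC₂ : C₂ = R₂ ∩ O₂) (hFC₂ : F ⊆ C₂)
    (hsdr₁ : Homotopy.IsStrongDeformationRetractOf F C₁)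
    (hsdr₂ : Homotopy.IsStrongDeformationRetractOf F C₂)
    (hR₁pc : IsPathConnected R₁) (hR₂pc : IsPathConnected R₂) (hFpc : IsPathConnected F)
    {x₀ : X} (hx₀ : x₀ ∈ F) [Subsingleton (_root_.FundamentalGroup R₂ ⟨x₀, hFR₂ hx₀⟩)] :
    Function.Surjective (inclHomOfSubset (subset_union_left : R₁ ⊆ R₁ ∪ R₂) x₀ (hFR₁ hx₀)
        ((hFR₁.trans subset_union_left : F ⊆ R₁ ∪ R₂) hx₀)) ∧
      (inclHomOfSubset (subset_union_left : R₁ ⊆ R₁ ∪ R₂) x₀ (hFR₁ hx₀)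
          ((hFR₁.trans subset_union_left : F ⊆ R₁ ∪ R₂) hx₀)).ker =
        Subgroup.normalClosure (Set.range (inclHomOfSubset hFR₁ x₀ hx₀ (hFR₁ hx₀))) := by
  have hW : F ⊆ R₁ ∪ R₂ := hFR₁.trans subset_union_left
  set i₁ := inclHomOfSubset (subset_union_left : R₁ ⊆ R₁ ∪ R₂) x₀ (hFR₁ hx₀) (hW hx₀) with hi₁
  set i₂ := inclHomOfSubset (subset_union_right : R₂ ⊆ R₁ ∪ R₂) x₀ (hFR₂ hx₀) (hW hx₀) with hi₂
  have hr₂ : Set.range i₂ ⊆ {1} := by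
    rintro _ ⟨a, rfl⟩
    rw [Set.mem_singleton_iff, Subsingleton.elim a 1, map_one]
  constructor
  · -- generation, with `π₁ R₂ = 1`
    have hgen := closure_range_union_eq_top_of_closed_cover_collars hR₁ hR₂ hFR₁ hFR₂ hF hO₁ hC₁
      hFC₁ hO₂ hC₂ hFC₂ hsdr₁ hsdr₂ hR₁pc hR₂pc hFpc hx₀
    rw [← MonoidHom.range_eq_top, eq_top_iff, ← hgen, Subgroup.closure_le, MonoidHom.coe_range]
    refine Set.union_subset Subset.rfl (hr₂.trans ?_)
    rintro _ rfl
    exact ⟨1, map_one _⟩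
  · apply le_antisymm
    · -- `ker ≤ N`: map to `π₁ R₁ ⧸ N` by the universal property
      set N := Subgroup.normalClosure (Set.range (inclHomOfSubset hFR₁ x₀ hx₀ (hFR₁ hx₀))) with hN
      let q : _root_.FundamentalGroup R₁ ⟨x₀, hFR₁ hx₀⟩ →* _ ⧸ N := QuotientGroup.mk' N
      have compat : q.comp (inclHomOfSubset hFR₁ x₀ hx₀ (hFR₁ hx₀)) =
          (1 : _root_.FundamentalGroup R₂ ⟨x₀, hFR₂ hx₀⟩ →* _ ⧸ N).comp
            (inclHomOfSubset hFR₂ x₀ hx₀ (hFR₂ hx₀)) := by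
        refine MonoidHom.ext fun a => ?_
        rw [MonoidHom.comp_apply, MonoidHom.comp_apply, MonoidHom.one_apply, QuotientGroup.mk'_apply,
          QuotientGroup.eq_one_iff]
        exact Subgroup.subset_normalClosure ⟨a, rfl⟩
      obtain ⟨Φ, ⟨hΦ₁, -⟩, -⟩ := existsUnique_hom_of_closed_cover_collars hR₁ hR₂ hFR₁ hFR₂ hF hO₁
        hC₁ hFC₁ hO₂ hC₂ hFC₂ hsdr₁ hsdr₂ hR₁pc hR₂pc hFpc hx₀ q 1 compat
      intro a ha
      rw [MonoidHom.mem_ker] at ha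
      have hq : q a = 1 := by
        rw [← hΦ₁, MonoidHom.comp_apply, ← hi₁, ha, map_one]
      rwa [QuotientGroup.mk'_apply, QuotientGroup.eq_one_iff] at hq
    · refine Subgroup.normalClosure_le_normal ?_
      rintro _ ⟨a, rfl⟩
      rw [SetLike.mem_coe, MonoidHom.mem_ker, hi₁, inclHomOfSubset_inclHomOfSubset,
        ← inclHomOfSubset_inclHomOfSubset hFR₂ subset_union_right hx₀ (hFR₂ hx₀) (hW hx₀)]
      exact hr₂ ⟨_, rfl⟩

/-- **Attaching a simply connected piece along a simply connected part of the boundary does not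
change `π₁`** (closed cover with collars, `π₁(R₂, x₀) = 1` and `π₁(F, x₀) = 1`): the map
`π₁(R₁, x₀) → π₁(R₁ ∪ R₂, x₀)` is bijective.  E.g. a `3`-manifold and a (half-)ball glued along a
disc: removing a half-ball bite at the boundary does not change the fundamental group.
[cite: HatcherAT2002, Thm. 1.20 and Prop. 1.26] -/
theorem bijective_of_closed_cover_collars_of_subsingleton {R₁ R₂ F C₁ C₂ O₁ O₂ : Set X}
    (hR₁ : IsClosed R₁) (hR₂ : IsClosed R₂) (hFR₁ : F ⊆ R₁) (hFR₂ : F ⊆ R₂) (hF : R₁ ∩ R₂ ⊆ F)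
    (hO₁ : IsOpen O₁) (hC₁ : C₁ = R₁ ∩ O₁) (hFC₁ : F ⊆ C₁)
    (hO₂ : IsOpen O₂) (hC₂ : C₂ = R₂ ∩ O₂) (hFC₂ : F ⊆ C₂)
    (hsdr₁ : Homotopy.IsStrongDeformationRetractOf F C₁)
    (hsdr₂ : Homotopy.IsStrongDeformationRetractOf F C₂)
    (hR₁pc : IsPathConnected R₁) (hR₂pc : IsPathConnected R₂) (hFpc : IsPathConnected F)
    {x₀ : X} (hx₀ : x₀ ∈ F) [Subsingleton (_root_.FundamentalGroup R₂ ⟨x₀, hFR₂ hx₀⟩)]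
    [Subsingleton (_root_.FundamentalGroup F ⟨x₀, hx₀⟩)] :
    Function.Bijective (inclHomOfSubset (subset_union_left : R₁ ⊆ R₁ ∪ R₂) x₀ (hFR₁ hx₀)
        ((hFR₁.trans subset_union_left : F ⊆ R₁ ∪ R₂) hx₀)) := by
  obtain ⟨hs, hk⟩ := surjective_and_ker_eq_of_closed_cover_collars_of_subsingleton_right hR₁ hR₂
    hFR₁ hFR₂ hF hO₁ hC₁ hFC₁ hO₂ hC₂ hFC₂ hsdr₁ hsdr₂ hR₁pc hR₂pc hFpc hx₀
  refine ⟨?_, hs⟩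
  rw [← MonoidHom.ker_eq_bot_iff, hk, eq_bot_iff]
  refine Subgroup.normalClosure_le_normal ?_
  rintro _ ⟨a, rfl⟩
  rw [Subsingleton.elim a 1, map_one]
  exact one_mem _

end ClosedCover

end VanKampen

end Literature.AlgebraicTopology.FundamentalGroup
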